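import Literature.MathematicalPhysics.QuantumLattice.GrassmannZoneLipschitzDB
import HarnessLib

/-!
# The inhomogeneous interaction-Lipschitz bound with DIAMETER weights: a defect at distance `≥ R` from the pin costs `φ(R)⁻¹`

Topic `MathematicalPhysics/QuantumLattice`; the user-facing form of `GrassmannZoneLipschitzDB.const_mul_sum_norm_kernel_effAction_add_sub_le_of_gramBounded`
for the diameter tree weights `diamWeight φ d S = φ(diam_d S)` of `SubmultiplicativeTreeWeight` (`φ ≥ 1` monotone submultiplicative: `1 + c·s`,
`(1 + c·s)^N`, `e^{c·s}`): if every kernel of the defect `V₂` touches the zone `Z` and the pin `w` is at `d`-distance `≥ R` from `Z`, then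
`Σ_{W : W_i = w} ‖kernel_m (effAction C (V₁ + V₂)) (W) − kernel_m (effAction C V₁) (W)‖ ≤ φ(R)⁻¹ · ρ^{-m} e‖V₂‖_{h,φ} / (1 − θ)²`
(Benfatto–Giuliani–Mastropietro 2006 (2.86)–(2.90) with the position-space moments of §3: the anchored tree joins the pin to the zone).
This is the step «fine action vs glued coarse actions differ at O(1) near the box boundaries but are compared at deep pins» of a nested two-volume
comparison of effective actions.

* **`sum_norm_kernel_effAction_add_sub_le_of_zone_of_gramBounded`** — the displayed bound.

Everything is proved; no definition, no named fact.

## Sources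
G. Benfatto, A. Giuliani, V. Mastropietro, Ann. Henri Poincaré 7 (2006) 809–898, (2.86)–(2.90), §3 (3.2)–(3.8) [`BenfattoGiulianiMastropietro2006`].
-/

noncomputable section

namespace Literature.MathematicalPhysics.QuantumLattice

open GrassmannAlgebra Finset Literature.Probability.LatticeModels Literature.Probability.LatticeModels.BattleFederbush

universe u

variable {𝕜 : Type*} [RCLike 𝕜] {Γ : Type u} [Fintype Γ] [DecidableEq Γ] (C : Matrix Γ Γ 𝕜)

/-- **INTERACTION DEFECT NEAR A ZONE, PIN FAR FROM IT: `φ(R)⁻¹` suppression** (diameter-weighted norms; BGM 2006 (2.86)–(2.90) with §3 (3.2)–(3.8)):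
replica-Gram-bounded `C` (constant `κ`), `φ(d)`-weighted row/column sums `≤ α`, even `V₁, V₂` without constant part with `φ(diam)`-weighted pinned
profiles `N₁, N₂`, `θ = eα(‖V₁‖ + ‖V₂‖)/κ² < 1`, every kernel of `V₂` touching `Z`, `d(z, w) ≥ R` on `Z`; then in every degree `m ≥ 1`
`Σ_{W : W_i = w} ‖kernel_m (effAction C (V₁+V₂)) (W) − kernel_m (effAction C V₁) (W)‖ ≤ φ(R)⁻¹ · ρ^{-m} e‖V₂‖_{h,φ} / (1 − θ)²`.
[cite: BenfattoGiulianiMastropietro2006, (2.86)-(2.90) and §3 (3.2)-(3.8)] -/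
theorem sum_norm_kernel_effAction_add_sub_le_of_zone_of_gramBounded {κ : ℝ} (hκ : 0 < κ) (hGB : IsGramBoundedR C κ)
    (d : Γ → Γ → ℝ) (hd : IsLabelDist d) {φ : ℝ → ℝ} (h1 : ∀ s, 0 ≤ s → 1 ≤ φ s) (hmono : ∀ s t, 0 ≤ s → s ≤ t → φ s ≤ φ t)
    (hsub : ∀ s t, 0 ≤ s → 0 ≤ t → φ (s + t) ≤ φ s * φ t)
    (V₁ V₂ : GrassmannAlgebra 𝕜 Γ) (hV₁ : V₁ ∈ evenPart 𝕜 Γ) (hV₂ : V₂ ∈ evenPart 𝕜 Γ)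
    (hV₁0 : constPart 𝕜 V₁ = 0) (hV₂0 : constPart 𝕜 V₂ = 0) (N₁ N₂ : ℕ → ℝ) (hN₁0 : ∀ m', 0 ≤ N₁ m') (hN₂0 : ∀ m', 0 ≤ N₂ m')
    (hN₁ : ∀ m' (j : Fin (2 * m')) (w : Γ), ∑ Y ∈ univ.filter (fun Y : Fin (2 * m') → Γ => Y j = w),
      ‖kernel 𝕜 V₁ (2 * m') Y‖ * diamWeight φ d (univ.image Y) ≤ N₁ m')
    (hN₂ : ∀ m' (j : Fin (2 * m')) (w : Γ), ∑ Y ∈ univ.filter (fun Y : Fin (2 * m') → Γ => Y j = w),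
      ‖kernel 𝕜 V₂ (2 * m') Y‖ * diamWeight φ d (univ.image Y) ≤ N₂ m')
    {α : ℝ} (hα : 0 < α) (hrow : ∀ X, ∑ Y, ‖C X Y‖ * diamWeight φ d {X, Y} ≤ α) (hcol : ∀ Y, ∑ X, ‖C X Y‖ * diamWeight φ d {X, Y} ≤ α)
    {ρ : ℝ} (hρ : 0 < ρ) (hθ : Real.exp 1 * α * (normV Γ κ ρ N₁ + normV Γ κ ρ N₂) / κ ^ 2 < 1)
    (Z : Set Γ) (hZ : ∀ (m' : ℕ) (Y : Fin (2 * m') → Γ), kernel 𝕜 V₂ (2 * m') Y ≠ 0 → ∃ j, Y j ∈ Z)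
    (w : Γ) {R : ℝ} (hR : 0 ≤ R) (hw : ∀ z ∈ Z, R ≤ d z w) {m : ℕ} (hm : 0 < m) (i : Fin m) :
    ∑ W ∈ univ.filter (fun W : Fin m → Γ => W i = w),
        ‖kernel 𝕜 (effAction 𝕜 C (V₁ + V₂)) m W - kernel 𝕜 (effAction 𝕜 C V₁) m W‖ ≤
      (φ R)⁻¹ * (ρ⁻¹ ^ m * (Real.exp 1 * normV Γ κ ρ N₂) / (1 - Real.exp 1 * α * (normV Γ κ ρ N₁ + normV Γ κ ρ N₂) / κ ^ 2) ^ 2) := by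
  have hwt : IsTreeWeight (diamWeight φ d) := isTreeWeight_diamWeight hd h1 hmono hsub
  have hφR : 0 < φ R := zero_lt_one.trans_le (h1 R hR)
  -- admissibility of `Λ := φ R`: a label set containing `w` and a point of `Z` has diameter `≥ R`
  have hΛ : ∀ S : Finset Γ, w ∈ S → (∃ z ∈ S, z ∈ Z) → φ R ≤ diamWeight φ d S := by
    rintro S hwS ⟨z, hzS, hzZ⟩
    exact hmono _ _ hR ((hw z hzZ).trans (le_labelDiam d hzS hwS))
  have h := const_mul_sum_norm_kernel_effAction_add_sub_le_of_gramBounded C hwt hκ hGB V₁ V₂ hV₁ hV₂ hV₁0 hV₂0 N₁ N₂ hN₁0 hN₂0 hN₁ hN₂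
    hα hrow hcol hρ hθ Z hZ w hφR.le hΛ hm i
  rw [le_inv_mul_iff₀ hφR]
  exact h

end Literature.MathematicalPhysics.QuantumLattice

end
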